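import Summits.QuantumFields.YangMills.Theorems.BalabanUVNodesN15NeumannCubeDivergenceDefect
import Summits.QuantumFields.YangMills.Theorems.BalabanUVNodesN15TwoSpacingGluingNeumannRemainder
import HarnessLib

/-!
# Route «BalabanUVNodes» (K3⁷), node N15 = NE2, -a lane, PROGRAMME N file N-IIn: THE RIGHT FIRST-ORDER ENTRIES OF THE NEUMANN CUBE IN THE CONSUMER's SANDWICHED FORM — `G(□)∘∇⁻_μ`
# (backward ∕ adjoint: identity, rows at both spacings, two-grid defect, all BY NAME) and `G(□)∘∇_μ` (forward: identity and rows; a SOURCE-side unit shift costs `2e^{ρ}`), with the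
# forward entry's two-grid defect LOCATED as the one item no typed (1.110) letter controls (dag-n15-c g13 WANT-n15-a (g13-1))

Cell `pub-ymgap`, seat `pub-ymgap-dag-n15-a` (KNIT-BY-NAME, g22; HUMAN RULING D-0062; chair R424 venue; `bears_on: R4∕N15`); `--kind proof --supports stmt-QuantumFields-20544 --as helper`.
Sequel of N-IId ∕ N-IIg (`…NeumannCubeDivergence(Defect)`).  CONSUMER: dag-n15-c g13 (E1)∕(E2) — FILE 83 `…TwoSpacingGluingCutEntries` (cut ∕ sandwiched cube rows as hypotheses) and FILE 49's
cut edition (the adjoint remainder `R̃ = Σ_k M_{h_k}G(□_k)[Δ_a, M_{h_k}]`, where `G(□)` meets `∇_μ` and `∇⁻_μ` on its SOURCE side behind derivatives of the partition function).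

WHAT.  Doubled torus `M_ν = 2S`, cube `□ + c` of side `S`, spacing `n`, `G(□) = neumannCubeG`, `G_□ = M_{χ_□}∘G(□)`; `∇_μ = ρ(sD_μ n)` (forward), `∇⁻_μ = bgrad n μ = −∇*_μ` (backward);
`T⁻_μ := −(χ_□∘Sym∘(G∘∇*_μ)∘M_{χ_□})`, `T⁺_μ := χ_□∘Sym∘(G∘∇_μ)∘M_{χ_□}`:
* §1 (backward, BY NAME) ★ `chiCube_neumannCubeG_comp_bgrad_mulOp` ((a)⁻: `G_□∘∇⁻_μ∘M_g = T⁻_μ∘M_g` for `g` supported with its `+e_μ`-translates in `□` — N-IId's identity +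
  `bgrad_eq_neg_symbOp`), ★★ `hasMaj_rightBgrad_pair` ((b)⁻: `T⁻_μ ≤ 1_□1_□·β·e^{−δd}` at both spacings of the torus family — N-IId `hasMaj_chiCube_symOp_gDivAdj_pair`), ★★★ `hasMaj_idef_rightBgrad`
  ((c)⁻: `𝔇(T⁻′_μ, T⁻_μ) ≤ 1_□1_□·m·(L^k)^{−1∕(8(d+1))}·e^{−δd}` — N-IIg `hasMaj_idef_chiCube_gDivAdj`);
* §2 (the source shift) ★★ `hasMaj_comp_pull_of_fibres` (GENERIC: `T ≤ K` ⟹ `T∘(pull s) ≤ K′` with `K′(y,y′) ≥ Σ_{z : some x ∈ block z has s x ∈ block y′} K(y,z)` — a source relabelling splits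
  a localized source over the fibre's blocks), ★★ `hasMaj_comp_fshift` (a SOURCE-side unit shift `ρ(s_κ)` under King's unit blocks costs `2e^{ρ}`: `blockOf_add_unitVec`'s dichotomy),
  ★ `symbOp_sD_eq_neg_divAdj_comp_sT` (`∇_μ = −∇*_μ∘S_μ` on either torus: `ρ(sD_μ c) = −ρ(c(s_μ⁻¹ − 1))∘ρ(s_μ)`), ★★ `hasMaj_gGrad_of_ineq` (the torus letter `G∘∇_μ ≤ 2Ce^{δ₀}·e^{−δ₀d}` from
  (1.110)'s `G∇*` entry: Bałaban's `G = Δ_a⁻¹` commutes with BLOCK translations only (`a•Q*Q` is block-periodic), not with unit ones, so `G∘∇_μ ≠ ∇_μ∘G` — the shift, not «symbol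
  commutation», is the mechanism);
* §3 (forward) ★ `chiCube_neumannCubeG_comp_sD_mulOp` ((a)⁺: `G_□∘∇_μ∘M_g = T⁺_μ∘M_g` for `g` supported with its `−e_μ`-translates in `□`), ★★ `hasMaj_rightGrad_pair` ((b)⁺: `T⁺_μ ≤ 1_□1_□·β·e^{−δd}`
  at both spacings).
LOCATED, NOT TYPED HERE: (c)⁺ `𝔇(T⁺′_μ, T⁺_μ)` — typed CONDITIONALLY on the torus letter of `𝔇(G′∘ρ(sD′_ν n′), G∘ρ(sD_ν n))` in the sequel N-IIo `…NeumannCubeRightEntriesDefect`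
(dag-n15-c g13: «GO CONDITIONAL on `hSrc`»).  By `∇_μ = −∇*_μ∘S_μ` the pair is `(−Y′∘S′_μ, −Y∘S_μ)` with `Y = χSym(G∇*)M_χ`, and `𝔇(Y′S′, YS) = 𝔇(Y′,Y)∘S + Y′∘((S′−1)P − P(S−1))`: the second term
is a SOURCE-side own-direction difference of `G′∇*′` (`G∇*∇`-type), which no typed (1.110) letter controls (the OUTPUT-side twin `(S−1)∘G∇* = n⁻¹∇G∇*` is entry 4 — that asymmetry is why N-IIe∕N-IIg
close and (c)⁺ does not by the same road; the reflection road `ℛ∇_μℛ = −∇*_μ`, `reflVR_comp_gOp` meets N-IIa's input-side `mask∘P∘ℛ∘D`).  It needs ONE source-regularity letter (the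
`S.holder` forms (1.112)–(1.113) of `B5.Ineq110_114`, or King Prop. 3.9 p.665 in the source variable) — to be typed CONDITIONALLY on request.
HONEST FRAMING.  Lattice algebra + block-majorant bookkeeping over LANDED rows ((1.110) letters via `ineq110_114_pair`); no new analytic estimate; `U ≡ 1` torus MODEL of [B5] §1 (doubled
cube tori); nothing of [B6] (2.38)–(2.40)∕[B9] asserted; N15 NOT discharged (object-bound; NE2⁺ NOT PRINTED); counts UNMOVED (typed 28∕28 · discharged 5∕27); one finite torus pair per index —
NOT continuum ∕ ℝ⁴ ∕ OS ∕ mass gap ∕ Clay.  Theorems only (0 `def`).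
-/

noncomputable section

open scoped BigOperators Matrix
open Finset

namespace Summit.QuantumFields.YangMills.BalabanUVNodes.N15.TwoGrid

open Literature.MathematicalPhysics.QuantumFieldTheory.Balaban1983to89
open Literature.MathematicalPhysics.QuantumFieldTheory.Balaban1983to89.B5Prop11Plancherel (Tor fine unitVec)
open Literature.MathematicalPhysics.QuantumFieldTheory.Balaban1983to89.B6Prop26Gluing (mulOp mulOp_apply ind ind_nonneg ind_le_one)
open Literature.MathematicalPhysics.QuantumFieldTheory.Balaban1983to89.B6RandomWalk (blockPiece sum_blockPiece)
open Literature.MathematicalPhysics.QuantumFieldTheory.King1986.Torus (blockOf tdistT tdistT_nonneg tdistT_symm tdistT_self tdistT_triangle tdistT_sub_unitVec_le)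
open Literature.MathematicalPhysics.QuantumFieldTheory.Balaban1983to89.T4EtaRateDefect (idef idef_apply)
open Literature.MathematicalPhysics.QuantumFieldTheory.Balaban1983to89.T4EtaRateCoeffDefect (pull pull_apply)
open Literature.MathematicalPhysics.QuantumFieldTheory.Balaban1983to89.B11SectG (BlockNorm HasMaj)
open Literature.MathematicalPhysics.QuantumFieldTheory.Balaban1983to89.B11AxialTransport190 (abs_le_loc_ofBlocks loc_ofBlocks_le)
open Literature.MathematicalPhysics.QuantumFieldTheory.Balaban1983to89.B6UnitTorusCarrier (unitTorusGeo)
open Literature.MathematicalPhysics.QuantumFieldTheory.Balaban1983to89.B5SiteBridgeP12 (MP)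
open Literature.MathematicalPhysics.QuantumFieldTheory.Balaban1983to89.B5SettingP12Real (latticeSettingP12R)
open Summit.QuantumFields.YangMills.BalabanUVNodes.N15.VectorPiece (bshiftEquiv kingPrV blkFine blockOf_add_unitVec)
open Summit.QuantumFields.YangMills.BalabanUVNodes.N15.BackgroundLayer (fgrad bgrad)
open Summit.QuantumFields.YangMills.BalabanUVNodes.N15.Gluing (bgrad_eq_neg_symbOp idef_neg)

variable {d : ℕ}

/-! ## §1 The backward ∕ adjoint right entry `G(□)∘∇⁻_μ` — identity, rows, two-grid defect, by name -/

section Backward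

variable {L : ℕ} {M : Fin (d + 1) → ℕ} [∀ μ, NeZero (M μ)] {k n : ℕ} [NeZero n] {c : Tor M} {S : ℕ}

/-- ★ **(a)⁻ THE SANDWICHED IDENTITY FOR `∇⁻_μ`**: for a multiplier `g` supported on bonds whose block AND whose `μ`-successor's block lie in the cube,
`G_□ ∘ ∇⁻_μ ∘ M_g = T⁻_μ ∘ M_g`, `T⁻_μ = −(χ_□ ∘ Sym ∘ (G∘∇*_μ) ∘ M_{χ_□})` (`∇⁻_μ = bgrad n μ = −∇*_μ`) — N-IId `chiCube_neumannCubeG_comp_divAdj_mulOp` read through `bgrad_eq_neg_symbOp`.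
[cite: Balaban1984PropagatorsI, (1.3) p.18 (lattice derivatives), Prop. 1.2 (1.110) p.35 (entry «G∇*»)] -/
theorem chiCube_neumannCubeG_comp_bgrad_mulOp (hM : ∀ ν, M ν = 2 * S) (hn : 1 ≤ n) {a : ℝ} (ha : 0 < a) (μ : Fin (d + 1)) {g : Tor (fine n M) × Fin (d + 1) → ℝ}
    (hg : ∀ b, g b ≠ 0 → blockOf n M b.1 ∈ cubeBlocks M c S ∧ blockOf n M (b.1 + unitVec (fine n M) μ) ∈ cubeBlocks M c S) :
    (mulOp (chiCube M n c S) ∘ₗ neumannCubeG M n c S a) ∘ₗ bgrad (n : ℝ) (bshiftEquiv M n μ) ∘ₗ mulOp g =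
      -((mulOp (chiCube M n c S) ∘ₗ symOp M n c ∘ₗ (gOp M n a ∘ₗ symbOp M n ((n : ℝ) • (sTinv M n μ - 1))) ∘ₗ mulOp (chiCube M n c S)) ∘ₗ mulOp g) := by
  rw [bgrad_eq_neg_symbOp, LinearMap.neg_comp, LinearMap.comp_neg, chiCube_neumannCubeG_comp_divAdj_mulOp hM hn ha μ hg]

variable [NeZero L]

/-- ★★ **(b)⁻ THE ROWS OF `T⁻_μ` AT BOTH SPACINGS of the torus family** (`−(χ_□∘Sym∘(G∘∇*_μ)∘M_{χ_□}) ≤ 1_□1_□·β·e^{−δd}`), uniform in every index — N-IId `hasMaj_chiCube_symOp_gDivAdj_pair`, negated.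
[cite: Balaban1984PropagatorsII, (2.133) p.247 (shape); Balaban1984PropagatorsI, Prop. 1.2 (1.110) p.35] -/
theorem hasMaj_rightBgrad_pair (hL : Odd L ∧ 1 < L) {a : ℝ} (ha : 0 < a) :
    ∃ δ β : ℝ, 0 < δ ∧ 0 < β ∧ ∀ (mT k r : ℕ) (hk : 1 ≤ k) (c : Tor (MP (paramsOf d L mT k hL))) (ν : Fin (d + 1)),
      HasMaj (BlockNorm.ofBlocks (unitTorusGeo L k (MP (paramsOf d L mT k hL))) (blkFine L k (MP (paramsOf d L mT k hL))))
          (BlockNorm.ofBlocks (unitTorusGeo L k (MP (paramsOf d L mT k hL))) (blkFine L k (MP (paramsOf d L mT k hL))))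
          (-(mulOp (chiCube (MP (paramsOf d L mT k hL)) (L ^ k) c (L ^ mT)) ∘ₗ symOp (MP (paramsOf d L mT k hL)) (L ^ k) c ∘ₗ
            (gOp (MP (paramsOf d L mT k hL)) (L ^ k) a ∘ₗ
              symbOp (MP (paramsOf d L mT k hL)) (L ^ k) (((L ^ k : ℕ) : ℝ) • (sTinv (MP (paramsOf d L mT k hL)) (L ^ k) ν - 1))) ∘ₗ
            mulOp (chiCube (MP (paramsOf d L mT k hL)) (L ^ k) c (L ^ mT))))
          (fun y y' => ind ((cubeBlocks (MP (paramsOf d L mT k hL)) c (L ^ mT) : Finset _) : Set _) y *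
            ind ((cubeBlocks (MP (paramsOf d L mT k hL)) c (L ^ mT) : Finset _) : Set _) y' * (β * Real.exp (-(δ * tdistT (MP (paramsOf d L mT k hL)) y y')))) ∧
        HasMaj (BlockNorm.ofBlocks (unitTorusGeo L k (MP (paramsOf d L mT k hL)))
            (fun i : Tor (fine (L ^ r * L ^ k) (MP (paramsOf d L mT k hL))) × Fin (d + 1) => blockOf (L ^ r * L ^ k) (MP (paramsOf d L mT k hL)) i.1))
          (BlockNorm.ofBlocks (unitTorusGeo L k (MP (paramsOf d L mT k hL)))
            (fun i : Tor (fine (L ^ r * L ^ k) (MP (paramsOf d L mT k hL))) × Fin (d + 1) => blockOf (L ^ r * L ^ k) (MP (paramsOf d L mT k hL)) i.1))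
          (-(mulOp (chiCube (MP (paramsOf d L mT k hL)) (L ^ r * L ^ k) c (L ^ mT)) ∘ₗ symOp (MP (paramsOf d L mT k hL)) (L ^ r * L ^ k) c ∘ₗ
            (gOp (MP (paramsOf d L mT k hL)) (L ^ r * L ^ k) a ∘ₗ
              symbOp (MP (paramsOf d L mT k hL)) (L ^ r * L ^ k)
                (((L ^ r * L ^ k : ℕ) : ℝ) • (sTinv (MP (paramsOf d L mT k hL)) (L ^ r * L ^ k) ν - 1))) ∘ₗ
            mulOp (chiCube (MP (paramsOf d L mT k hL)) (L ^ r * L ^ k) c (L ^ mT))))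
          (fun y y' => ind ((cubeBlocks (MP (paramsOf d L mT k hL)) c (L ^ mT) : Finset _) : Set _) y *
            ind ((cubeBlocks (MP (paramsOf d L mT k hL)) c (L ^ mT) : Finset _) : Set _) y' * (β * Real.exp (-(δ * tdistT (MP (paramsOf d L mT k hL)) y y')))) := by
  obtain ⟨δ, β, hδ, hβ, H⟩ := hasMaj_chiCube_symOp_gDivAdj_pair (d := d) hL ha
  exact ⟨δ, β, hδ, hβ, fun mT k r hk c ν => ⟨(H mT k r hk c ν).1.neg, (H mT k r hk c ν).2.neg⟩⟩

/-- ★★★ **(c)⁻ THE TWO-GRID η-DEFECT OF `T⁻_μ`**: `𝔇(T⁻′_μ, T⁻_μ) ≤ 1_□1_□·m·(L^k)^{−1∕(8(d+1))}·e^{−δd}` (for `4 ≤ L^k`), for every `m_T`, `k`, `r`, corner `c`, direction `ν` — N-IIg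
`hasMaj_idef_chiCube_gDivAdj` under `idef_neg`. [cite: Balaban1984PropagatorsII, (2.133)–(2.136) p.247 (shapes); Balaban1984PropagatorsI, (1.111) p.36, (1.121)–(1.123) p.37; King1986,
Prop. 3.9 p.665 (Hölder-rate shape)] -/
theorem hasMaj_idef_rightBgrad (hLodd : Odd L) (hL2 : 2 ≤ L) {a : ℝ} (ha : 0 < a) :
    ∃ δ m : ℝ, 0 < δ ∧ 0 < m ∧ ∀ (mT k r : ℕ) (hk : 1 ≤ k) (hn4 : 4 ≤ L ^ k) (hL : Odd L ∧ 1 < L) (c : Tor (MP (paramsOf d L mT k hL))) (ν : Fin (d + 1)),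
      HasMaj (BlockNorm.ofBlocks (unitTorusGeo L k (MP (paramsOf d L mT k hL))) (blkFine L k (MP (paramsOf d L mT k hL))))
        (BlockNorm.ofBlocks (unitTorusGeo L k (MP (paramsOf d L mT k hL)))
          (fun i : Tor (fine (d := d + 1) (L ^ r * L ^ k) (MP (paramsOf d L mT k hL))) × Fin (d + 1) => blockOf (L ^ r * L ^ k) (MP (paramsOf d L mT k hL)) i.1))
        (idef (pull (kingPrV L k r (MP (paramsOf d L mT k hL)))) (pull (kingPrV L k r (MP (paramsOf d L mT k hL))))
          (-(mulOp (chiCube (MP (paramsOf d L mT k hL)) (L ^ r * L ^ k) c (L ^ mT)) ∘ₗ symOp (MP (paramsOf d L mT k hL)) (L ^ r * L ^ k) c ∘ₗ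
            (gOp (MP (paramsOf d L mT k hL)) (L ^ r * L ^ k) a ∘ₗ
              symbOp (MP (paramsOf d L mT k hL)) (L ^ r * L ^ k)
                (((L ^ r * L ^ k : ℕ) : ℝ) • (sTinv (MP (paramsOf d L mT k hL)) (L ^ r * L ^ k) ν - 1))) ∘ₗ
            mulOp (chiCube (MP (paramsOf d L mT k hL)) (L ^ r * L ^ k) c (L ^ mT))))
          (-(mulOp (chiCube (MP (paramsOf d L mT k hL)) (L ^ k) c (L ^ mT)) ∘ₗ symOp (MP (paramsOf d L mT k hL)) (L ^ k) c ∘ₗ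
            (gOp (MP (paramsOf d L mT k hL)) (L ^ k) a ∘ₗ
              symbOp (MP (paramsOf d L mT k hL)) (L ^ k) (((L ^ k : ℕ) : ℝ) • (sTinv (MP (paramsOf d L mT k hL)) (L ^ k) ν - 1))) ∘ₗ
            mulOp (chiCube (MP (paramsOf d L mT k hL)) (L ^ k) c (L ^ mT)))))
        (fun y y' => ind ((cubeBlocks (MP (paramsOf d L mT k hL)) c (L ^ mT) : Finset _) : Set _) y *
          ind ((cubeBlocks (MP (paramsOf d L mT k hL)) c (L ^ mT) : Finset _) : Set _) y' *
          (m * ((L ^ k : ℕ) : ℝ) ^ (-(1 / (8 * ((d : ℝ) + 1)))) * Real.exp (-(δ * tdistT (MP (paramsOf d L mT k hL)) y y')))) := by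
  obtain ⟨δ, m, hδ, hm, H⟩ := hasMaj_idef_chiCube_gDivAdj (d := d) hLodd hL2 ha
  refine ⟨δ, m, hδ, hm, fun mT k r hk hn4 hL c ν => ?_⟩
  rw [idef_neg]
  exact (H mT k r hk hn4 hL c ν).neg

end Backward

/-! ## §2 A source-side relabelling splits a localized source over the fibre's blocks; a unit source shift costs `2e^{ρ}`; `G∘∇_μ` on the torus -/

section SourceShift

/-- ★★ **A SOURCE RELABELLING UNDER A FIXED BLOCK ASSIGNMENT**: if `T ≤ K` out of the sharp block sizes of `blk` (`K ≥ 0`) and, for every pair of blocks, `K′(y, y′)` dominates the sum of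
`K(y, z)` over the blocks `z` meeting the `s`-preimage of the block of `y′`, then `T ∘ (pull s) ≤ K′` — a source localized in `y′` is read by `T∘pull s` as a source split over those
blocks `z`. [cite: Balaban1984PropagatorsII, (2.52)–(2.55) pp.232–233 (block-majorant bookkeeping: shape)] -/
theorem hasMaj_comp_pull_of_fibres {g : B6.Geometry} {X : Type} [Fintype X] {F₂ : Type} [AddCommGroup F₂] [Module ℝ F₂] {b₂ : BlockNorm g F₂}
    (blk : X → g.Site) (s : X → X) {T : (X → ℝ) →ₗ[ℝ] F₂} {K K' : g.Site → g.Site → ℝ} (hK : ∀ y y', 0 ≤ K y y')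
    (hs : ∀ (y y' : g.Site) (B : Finset g.Site), (∀ z ∈ B, ∃ x, blk x = z ∧ blk (s x) = y') → ∑ z ∈ B, K y z ≤ K' y y')
    (h : HasMaj (BlockNorm.ofBlocks g blk) b₂ T K) : HasMaj (BlockNorm.ofBlocks g blk) b₂ (T ∘ₗ pull s) K' := by
  classical
  intro y' μ hμ y
  set ν : X → ℝ := pull s μ with hν
  set B : Finset g.Site := Finset.univ.filter (fun z => ∃ x, blk x = z ∧ blk (s x) = y') with hB
  have hBfib : ∀ z ∈ B, ∃ x, blk x = z ∧ blk (s x) = y' := fun z hz => (Finset.mem_filter.mp hz).2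
  -- the relabelled source, split over the blocks of the fibre
  have hpiece0 : ∀ z, z ∉ B → blockPiece blk z ν = 0 := by
    intro z hz
    funext x
    unfold blockPiece
    by_cases hx : blk x = z
    · rw [if_pos hx, hν, pull_apply]
      by_contra hne
      exact hz (Finset.mem_filter.mpr ⟨Finset.mem_univ _, x, hx, by_contra fun hsx => hne (hμ (s x) hsx)⟩)
    · rw [if_neg hx]; rfl
  have hsplit : ν = ∑ z ∈ B, blockPiece blk z ν := by
    rw [Finset.sum_subset (Finset.subset_univ B) (fun z _ hz => hpiece0 z hz), sum_blockPiece]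
  -- each piece is localized in its block and is bounded by the size of `μ` near `y′`
  have hloc : ∀ z, (BlockNorm.ofBlocks g blk).IsLoc z (blockPiece blk z ν) := fun z x hx => by
    show (if blk x = z then ν x else 0) = 0
    rw [if_neg hx]
  have hsize : ∀ z, (BlockNorm.ofBlocks g blk).loc z (blockPiece blk z ν) ≤ (BlockNorm.ofBlocks g blk).loc y' μ := by
    intro z
    refine loc_ofBlocks_le blk _ ((BlockNorm.ofBlocks g blk).loc_nonneg y' μ) fun x hx => ?_
    show |(if blk x = z then ν x else 0)| ≤ _
    rw [if_pos hx, hν, pull_apply]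
    by_cases hsx : blk (s x) = y'
    · exact abs_le_loc_ofBlocks blk μ hsx
    · rw [hμ (s x) hsx, abs_zero]; exact (BlockNorm.ofBlocks g blk).loc_nonneg y' μ
  -- sum the pieces
  have hsum : ∀ (B' : Finset g.Site), b₂.loc y (T (∑ z ∈ B', blockPiece blk z ν)) ≤ (∑ z ∈ B', K y z) * (BlockNorm.ofBlocks g blk).loc y' μ := by
    intro B'
    induction B' using Finset.induction_on with
    | empty => simp [b₂.loc_zero]
    | insert z B' hz ih =>
      rw [Finset.sum_insert hz, Finset.sum_insert hz, map_add, add_mul]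
      refine (b₂.loc_add_le y _ _).trans (add_le_add ?_ ih)
      exact (h z _ (hloc z) y).trans (mul_le_mul_of_nonneg_left (hsize z) (hK y z))
  rw [LinearMap.comp_apply, ← hν, hsplit]
  exact (hsum B).trans (mul_le_mul_of_nonneg_right (hs y y' B hBfib) ((BlockNorm.ofBlocks g blk).loc_nonneg y' μ))

variable {L : ℕ} {M : Fin (d + 1) → ℕ} [∀ μ, NeZero (M μ)] {k n : ℕ} [NeZero n]

omit [∀ μ, NeZero (M μ)] [NeZero n] in
/-- the forward unit shift `ρ(s_κ)` IS the source relabelling `pull (x ↦ x + e_κ)`. [folklore] -/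
theorem symbOp_sT_eq_pull (κ : Fin (d + 1)) : symbOp M n (sT M n κ) = pull (fun i : Tor (fine n M) × Fin (d + 1) => (i.1 + unitVec (fine n M) κ, i.2)) := by
  refine LinearMap.ext fun f => funext fun i => ?_
  rw [symbOp_sT_apply, pull_apply]

/-- ★★ **A SOURCE-SIDE UNIT SHIFT COSTS `2e^{ρ}`**: on the unit-torus carrier with the level-`n` fine bonds blocked by King's unit block of their base point, if `T ≤ B·e^{−ρ|y−y′|_T}` (`B, ρ ≥ 0`)
then `T ∘ ρ(s_κ) ≤ 2Be^{ρ}·e^{−ρ|y−y′|_T}` — the shifted source meets at most the block of `y′` and its `κ`-predecessor (`blockOf_add_unitVec`), both within torus distance `1`.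
[cite: Balaban1984PropagatorsII, (2.52)–(2.55) pp.232–233 (block-majorant bookkeeping: shape); King1986, p.664 (blocks B^k(x))] -/
theorem hasMaj_comp_fshift {F₂ : Type} [AddCommGroup F₂] [Module ℝ F₂] {b₂ : BlockNorm (unitTorusGeo L k M) F₂} {T : (Tor (fine n M) × Fin (d + 1) → ℝ) →ₗ[ℝ] F₂} {B' ρ : ℝ}
    (hB' : 0 ≤ B') (hρ : 0 ≤ ρ) (κ : Fin (d + 1))
    (h : HasMaj (BlockNorm.ofBlocks (unitTorusGeo L k M) (fun i : Tor (fine n M) × Fin (d + 1) => blockOf n M i.1)) b₂ T (fun y y' => B' * Real.exp (-(ρ * tdistT M y y')))) :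
    HasMaj (BlockNorm.ofBlocks (unitTorusGeo L k M) (fun i : Tor (fine n M) × Fin (d + 1) => blockOf n M i.1)) b₂ (T ∘ₗ symbOp M n (sT M n κ))
      (fun y y' => 2 * (B' * Real.exp ρ) * Real.exp (-(ρ * tdistT M y y'))) := by
  classical
  rw [symbOp_sT_eq_pull]
  refine hasMaj_comp_pull_of_fibres (g := unitTorusGeo L k M) (fun i : Tor (fine n M) × Fin (d + 1) => blockOf n M i.1) _
    (fun _ _ => mul_nonneg hB' (Real.exp_nonneg _)) (fun y y' => ?_) h
  -- the fibre's blocks are `y′` and `y′ − e_κ`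
  intro B hB
  have hsub : B ⊆ ({y', y' - unitVec M κ} : Finset (Tor M)) := by
    intro z hz
    obtain ⟨x, hxz, hxs⟩ := hB z hz
    dsimp only at hxs
    have hdich := blockOf_add_unitVec n M x.1 κ
    rw [hxs] at hdich
    rw [Finset.mem_insert, Finset.mem_singleton]
    by_cases hdvd : n ∣ (x.1 κ).val + 1
    · rw [if_pos hdvd] at hdich
      right; rw [← hxz, hdich, add_sub_cancel_right]
    · rw [if_neg hdvd] at hdich
      left; rw [← hxz, hdich]
  -- each of them is within torus distance `1` of `y′`
  have hterm : ∀ z ∈ ({y', y' - unitVec M κ} : Finset (Tor M)), B' * Real.exp (-(ρ * tdistT M y z)) ≤ B' * Real.exp ρ * Real.exp (-(ρ * tdistT M y y')) := by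
    intro z hz
    rw [mul_assoc, ← Real.exp_add]
    refine mul_le_mul_of_nonneg_left (Real.exp_le_exp.mpr ?_) hB'
    have hz1 : tdistT M z y' ≤ 1 := by
      rw [Finset.mem_insert, Finset.mem_singleton] at hz
      rcases hz with rfl | rfl
      · rw [tdistT_self]; exact zero_le_one
      · rw [tdistT_symm]; exact tdistT_sub_unitVec_le M y' κ
    have htri := tdistT_triangle M y z y'
    nlinarith
  calc ∑ z ∈ B, B' * Real.exp (-(ρ * tdistT M y z))
      ≤ ∑ z ∈ ({y', y' - unitVec M κ} : Finset (Tor M)), B' * Real.exp (-(ρ * tdistT M y z)) :=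
        Finset.sum_le_sum_of_subset_of_nonneg hsub fun z _ _ => mul_nonneg hB' (Real.exp_nonneg _)
    _ ≤ ∑ _z ∈ ({y', y' - unitVec M κ} : Finset (Tor M)), B' * Real.exp ρ * Real.exp (-(ρ * tdistT M y y')) := Finset.sum_le_sum hterm
    _ = (({y', y' - unitVec M κ} : Finset (Tor M)).card : ℝ) * (B' * Real.exp ρ * Real.exp (-(ρ * tdistT M y y'))) := by rw [Finset.sum_const, nsmul_eq_mul]
    _ ≤ 2 * (B' * Real.exp ρ * Real.exp (-(ρ * tdistT M y y'))) := by
        refine mul_le_mul_of_nonneg_right ?_ (by positivity)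
        have hc : (({y', y' - unitVec M κ} : Finset (Tor M)).card) ≤ 2 := (Finset.card_insert_le _ _).trans (by rw [Finset.card_singleton])
        exact_mod_cast hc
    _ = 2 * (B' * Real.exp ρ) * Real.exp (-(ρ * tdistT M y y')) := by ring

omit [∀ μ, NeZero (M μ)] [NeZero n] in
/-- ★ `∇_μ = −∇*_μ ∘ S_μ`: `ρ(sD_μ c) = −ρ(c(s_μ⁻¹ − 1)) ∘ ρ(s_μ)` — the forward difference is the adjoint difference read one step ahead. [cite: Balaban1984PropagatorsI, (1.3) p.18 (lattice
derivatives)] -/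
theorem symbOp_sD_eq_neg_divAdj_comp_sT (μ : Fin (d + 1)) (cc : ℝ) : symbOp M n (sD M n μ cc) = -(symbOp M n (cc • (sTinv M n μ - 1)) ∘ₗ symbOp M n (sT M n μ)) := by
  refine LinearMap.ext fun f => funext fun b => ?_
  rw [symbOp_sD_apply, LinearMap.neg_apply, Pi.neg_apply, LinearMap.comp_apply, symbOp_divAdj_apply, symbOp_sT_apply, symbOp_sT_apply]
  simp only [sub_add_cancel]
  ring

/-- ★★ **THE TORUS LETTER OF THE RIGHT FORWARD ENTRY `G∘∇_μ`**: from [B5] Prop. 1.2's inequalities at any spacing (`hasMaj_gDivAdj_of_ineq`: `G∘∇*_μ ≤ Ce^{−δ₀d}`),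
`G ∘ ρ(sD_μ n) ≤ 2Ce^{δ₀}·e^{−δ₀d}` — `G∘∇_μ = −(G∘∇*_μ)∘S_μ` and the source shift costs `2e^{δ₀}` (★★ `hasMaj_comp_fshift`).  (Bałaban's `G = Δ_a⁻¹` commutes with BLOCK translations
only — `a•Q*Q` is block-periodic — so `G∘∇_μ ≠ ∇_μ∘G`; the printed (1.110) has no «G∇» entry.) [cite: Balaban1984PropagatorsI, Prop. 1.2 (1.110) p.35 (entry «G∇*»), (1.3) p.18] -/
theorem hasMaj_gGrad_of_ineq (hn : 1 ≤ n) {a : ℝ} {K : ℕ} {C δ₀ : ℝ} {Cα Cε : ℝ → ℝ} {Cαε : ℝ → ℝ → ℝ}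
    (H : B5.Ineq110_114 (latticeSettingP12R n M a K) C Cα Cε Cαε δ₀) (hC : 0 ≤ C) (hδ₀ : 0 ≤ δ₀) (μ : Fin (d + 1)) :
    HasMaj (BlockNorm.ofBlocks (unitTorusGeo L k M) (fun i : Tor (fine n M) × Fin (d + 1) => blockOf n M i.1))
      (BlockNorm.ofBlocks (unitTorusGeo L k M) (fun i : Tor (fine n M) × Fin (d + 1) => blockOf n M i.1))
      (gOp M n a ∘ₗ symbOp M n (sD M n μ (n : ℝ))) (fun y y' => 2 * (C * Real.exp δ₀) * Real.exp (-(δ₀ * tdistT M y y'))) := by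
  rw [symbOp_sD_eq_neg_divAdj_comp_sT, LinearMap.comp_neg, ← LinearMap.comp_assoc]
  exact (hasMaj_comp_fshift hC hδ₀ μ (hasMaj_gDivAdj_of_ineq (L := L) (k := k) M n a hn H hC μ)).neg

end SourceShift

/-! ## §3 The forward right entry `G(□)∘∇_μ` — identity and rows -/

section Forward

variable {L : ℕ} {M : Fin (d + 1) → ℕ} [∀ μ, NeZero (M μ)] {k n : ℕ} [NeZero n] {c : Tor M} {S : ℕ}

/-- ★ **(a)⁺ THE SANDWICHED IDENTITY FOR `∇_μ`**: for a multiplier `g` supported on bonds whose block AND whose `μ`-predecessor's block lie in the cube,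
`G_□ ∘ ∇_μ ∘ M_g = T⁺_μ ∘ M_g` with `T⁺_μ = χ_□ ∘ Sym ∘ (G∘ρ(sD_μ n)) ∘ M_{χ_□}` and `G_□ = χ_□ ∘ G(□ + c)` — the forward difference slips inside the source cut exactly. [folklore] -/
theorem chiCube_neumannCubeG_comp_sD_mulOp (hM : ∀ ν, M ν = 2 * S) (hn : 1 ≤ n) {a : ℝ} (ha : 0 < a) (μ : Fin (d + 1)) {g : Tor (fine n M) × Fin (d + 1) → ℝ}
    (hg : ∀ b, g b ≠ 0 → blockOf n M b.1 ∈ cubeBlocks M c S ∧ blockOf n M (b.1 - unitVec (fine n M) μ) ∈ cubeBlocks M c S) :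
    (mulOp (chiCube M n c S) ∘ₗ neumannCubeG M n c S a) ∘ₗ symbOp M n (sD M n μ (n : ℝ)) ∘ₗ mulOp g =
      (mulOp (chiCube M n c S) ∘ₗ symOp M n c ∘ₗ (gOp M n a ∘ₗ symbOp M n (sD M n μ (n : ℝ))) ∘ₗ mulOp (chiCube M n c S)) ∘ₗ mulOp g := by
  have key : mulOp (chiCube M n c S) ∘ₗ symbOp M n (sD M n μ (n : ℝ)) ∘ₗ mulOp g =
      symbOp M n (sD M n μ (n : ℝ)) ∘ₗ mulOp (chiCube M n c S) ∘ₗ mulOp g := by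
    refine LinearMap.ext fun A => funext fun b => ?_
    simp only [LinearMap.comp_apply, mulOp_apply, symbOp_sD_apply]
    by_cases hgb : g (b.1 + unitVec (fine n M) μ, b.2) = 0
    · rw [hgb]
      by_cases hgb0 : g b = 0
      · rw [hgb0]; ring
      · obtain ⟨h1, -⟩ := hg _ hgb0
        rw [show chiCube M n c S b = 1 by unfold chiCube; rw [if_pos h1]]
        ring
    · obtain ⟨h1, h2⟩ := hg _ hgb
      dsimp only at h1 h2
      rw [add_sub_cancel_right] at h2
      rw [show chiCube M n c S b = 1 by unfold chiCube; rw [if_pos h2],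
        show chiCube M n c S (b.1 + unitVec (fine n M) μ, b.2) = 1 by unfold chiCube; rw [if_pos h1]]
      ring
  rw [neumannCubeG_eq_chiCube M n c S a hM hn ha]
  simp only [LinearMap.comp_assoc]
  rw [key]

/-- ★★ (b)⁺ at one spacing, from the torus letter: `G∘∇_μ ≤ C′e^{−δ₀d}` ⟹ `T⁺_μ ≤ 1_□1_□·2^{d+1}C′e^{δ₀}·e^{−δ₀d}`. [cite: Balaban1984PropagatorsII, (2.133) p.247 (shape), (2.37) p.229] -/
theorem hasMaj_chiCube_symOp_gGrad_of (hM : ∀ ν, M ν = 2 * S) {a C δ₀ : ℝ} (hC : 0 ≤ C) (hδ₀ : 0 ≤ δ₀) (μ : Fin (d + 1))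
    (hE : HasMaj (BlockNorm.ofBlocks (unitTorusGeo L k M) (fun b : Tor (fine n M) × Fin (d + 1) => blockOf n M b.1))
      (BlockNorm.ofBlocks (unitTorusGeo L k M) (fun b : Tor (fine n M) × Fin (d + 1) => blockOf n M b.1))
      (gOp M n a ∘ₗ symbOp M n (sD M n μ (n : ℝ))) (fun y y' => C * Real.exp (-(δ₀ * tdistT M y y')))) :
    HasMaj (BlockNorm.ofBlocks (unitTorusGeo L k M) (fun b : Tor (fine n M) × Fin (d + 1) => blockOf n M b.1))
      (BlockNorm.ofBlocks (unitTorusGeo L k M) (fun b : Tor (fine n M) × Fin (d + 1) => blockOf n M b.1))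
      (mulOp (chiCube M n c S) ∘ₗ symOp M n c ∘ₗ (gOp M n a ∘ₗ symbOp M n (sD M n μ (n : ℝ))) ∘ₗ mulOp (chiCube M n c S))
      (fun y y' => ind (cubeBlocks M c S : Set (Tor M)) y * ind (cubeBlocks M c S : Set (Tor M)) y' * (2 ^ (d + 1) * (C * Real.exp δ₀) * Real.exp (-(δ₀ * tdistT M y y')))) :=
  hasMaj_chiCube_symOp_comp hC hδ₀ hM (hasMaj_comp_mulOp_chiCube (c := c) (S := S) (fun _ _ => mul_nonneg hC (Real.exp_nonneg _)) hE)

variable [NeZero L]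

/-- ★★ **(b)⁺ THE ROWS OF `T⁺_μ` AT BOTH SPACINGS of the torus family** (`χ_□∘Sym∘(G∘ρ(sD_μ n))∘M_{χ_□} ≤ 1_□1_□·β·e^{−δd}`, coarse `n = L^k` in King's unit blocks, fine `n′ = L^r·L^k` in the blocks
read through the pairing), uniform in every index — ★★ `hasMaj_gGrad_of_ineq` on `ineq110_114_pair`'s both members, then the images ∕ cut bookkeeping of N-IIIb.
[cite: Balaban1984PropagatorsII, (2.133) p.247 (shape); Balaban1984PropagatorsI, Prop. 1.2 (1.110) p.35] -/
theorem hasMaj_rightGrad_pair (hL : Odd L ∧ 1 < L) {a : ℝ} (ha : 0 < a) :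
    ∃ δ β : ℝ, 0 < δ ∧ 0 < β ∧ ∀ (mT k r : ℕ) (hk : 1 ≤ k) (c : Tor (MP (paramsOf d L mT k hL))) (ν : Fin (d + 1)),
      HasMaj (BlockNorm.ofBlocks (unitTorusGeo L k (MP (paramsOf d L mT k hL))) (blkFine L k (MP (paramsOf d L mT k hL))))
          (BlockNorm.ofBlocks (unitTorusGeo L k (MP (paramsOf d L mT k hL))) (blkFine L k (MP (paramsOf d L mT k hL))))
          (mulOp (chiCube (MP (paramsOf d L mT k hL)) (L ^ k) c (L ^ mT)) ∘ₗ symOp (MP (paramsOf d L mT k hL)) (L ^ k) c ∘ₗ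
            (gOp (MP (paramsOf d L mT k hL)) (L ^ k) a ∘ₗ symbOp (MP (paramsOf d L mT k hL)) (L ^ k) (sD (MP (paramsOf d L mT k hL)) (L ^ k) ν ((L ^ k : ℕ) : ℝ))) ∘ₗ
            mulOp (chiCube (MP (paramsOf d L mT k hL)) (L ^ k) c (L ^ mT)))
          (fun y y' => ind ((cubeBlocks (MP (paramsOf d L mT k hL)) c (L ^ mT) : Finset _) : Set _) y *
            ind ((cubeBlocks (MP (paramsOf d L mT k hL)) c (L ^ mT) : Finset _) : Set _) y' * (β * Real.exp (-(δ * tdistT (MP (paramsOf d L mT k hL)) y y')))) ∧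
        HasMaj (BlockNorm.ofBlocks (unitTorusGeo L k (MP (paramsOf d L mT k hL)))
            (fun i : Tor (fine (L ^ r * L ^ k) (MP (paramsOf d L mT k hL))) × Fin (d + 1) => blockOf (L ^ r * L ^ k) (MP (paramsOf d L mT k hL)) i.1))
          (BlockNorm.ofBlocks (unitTorusGeo L k (MP (paramsOf d L mT k hL)))
            (fun i : Tor (fine (L ^ r * L ^ k) (MP (paramsOf d L mT k hL))) × Fin (d + 1) => blockOf (L ^ r * L ^ k) (MP (paramsOf d L mT k hL)) i.1))
          (mulOp (chiCube (MP (paramsOf d L mT k hL)) (L ^ r * L ^ k) c (L ^ mT)) ∘ₗ symOp (MP (paramsOf d L mT k hL)) (L ^ r * L ^ k) c ∘ₗ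
            (gOp (MP (paramsOf d L mT k hL)) (L ^ r * L ^ k) a ∘ₗ
              symbOp (MP (paramsOf d L mT k hL)) (L ^ r * L ^ k) (sD (MP (paramsOf d L mT k hL)) (L ^ r * L ^ k) ν ((L ^ r * L ^ k : ℕ) : ℝ))) ∘ₗ
            mulOp (chiCube (MP (paramsOf d L mT k hL)) (L ^ r * L ^ k) c (L ^ mT)))
          (fun y y' => ind ((cubeBlocks (MP (paramsOf d L mT k hL)) c (L ^ mT) : Finset _) : Set _) y *
            ind ((cubeBlocks (MP (paramsOf d L mT k hL)) c (L ^ mT) : Finset _) : Set _) y' * (β * Real.exp (-(δ * tdistT (MP (paramsOf d L mT k hL)) y y')))) := by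
  obtain ⟨δ₀, C, Cα, Cε, Cαε, hδ₀, hC, H⟩ := ineq110_114_pair (d := d) hL ha
  have hC' : 0 ≤ 2 * (C * Real.exp δ₀) := by positivity
  refine ⟨δ₀, 2 ^ (d + 1) * (2 * (C * Real.exp δ₀) * Real.exp δ₀), hδ₀, by positivity, fun mT k r hk c ν => ⟨?_, ?_⟩⟩
  · have hn : 1 ≤ L ^ k := Nat.one_le_pow _ _ (Nat.pos_of_ne_zero (NeZero.ne L))
    exact hasMaj_chiCube_symOp_gGrad_of (fun μ => rfl) hC' hδ₀.le ν (hasMaj_gGrad_of_ineq (L := L) (k := k) hn (H mT k r hk).1 hC.le hδ₀.le ν)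
  · have hn' : 1 ≤ L ^ r * L ^ k := Nat.one_le_iff_ne_zero.mpr (Nat.mul_ne_zero (pow_ne_zero r (NeZero.ne L)) (pow_ne_zero k (NeZero.ne L)))
    exact hasMaj_chiCube_symOp_gGrad_of (fun μ => rfl) hC' hδ₀.le ν (hasMaj_gGrad_of_ineq (L := L) (k := k) hn' (H mT k r hk).2 hC.le hδ₀.le ν)

end Forward

end Summit.QuantumFields.YangMills.BalabanUVNodes.N15.TwoGrid

end
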